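import Mathlib
import Literature.NumberTheory.Irrationality.CressonFischlerRivoal2008.WellPoisedSymmetry
import HarnessLib

/-!
HONEST FRAMING: systematic search; no irrationality claim unless certified.

# Well-poised series summed at the half-integers: `Σ_k P(k+½)/(k+½)_{n+1}^A ∈ ℚ + Σ_{s odd ≥ 3} ℚ·(2^s − 1)ζ(s)`

Cell `pub-zeta5`, lane `families/odd` (FAMILY.md §5.7–§5.10), fam-odd gen-3/gen-4 (part 1 of 2; part 2 is
`OddTwistHalfShift.lean`, the application to the twisted family `T`).

The printed mechanism is Zudilin's "twist by half" [Zudilin, SIGMA 14 (2018) 028 = arXiv:1801.09895, (1), Lemma 3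
and the display after it]: for a well-poised summand `R` with partial fractions `Σ_{i,k} a_{i,k}/(t+k)^i`, the two
series `r = Σ_{ν≥1} R(ν)` and `r̂ = Σ_{ν≥1} R(ν − ½)` have the SAME coefficients `a_i = Σ_k a_{i,k}`, namely
`r = a₀ + Σ_{i odd} a_i ζ(i)` and `r̂ = â₀ + Σ_{i odd} a_i (2^i − 1) ζ(i)`, because
`Σ_{ℓ ≥ 1} (ℓ − ½)^{−i} = (2^i − 1) ζ(i)`.  This file proves that mechanism in general form on top of the tree's
formalisation of Cresson–Fischler–Rivoal, Théorème 1 (`WellPoisedSymmetry`: partial fractions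
`exists_partialFractions`, vanishing polar part `partialFractions_sum_order_zero`, reflection kills even zetas
`partialFractions_sum_odd_order`):

* `hasSum_one_div_halfInt_pow` : `Σ_{m ≥ 0} (m + ½)^{−i} = (2^i − 1) ζ(i)` for `i ≥ 2` (parity split of `ζ(i)`);
  `hasSum_one_div_halfInt_pow_shift`, `hasSum_sub_halfShift` : the shifted / telescoped versions with the rational
  truncations `harmHalf i p = Ĥ_p^{(i)} = Σ_{m<p} (m+½)^{−i}`;
* `hasSum_partialFractions_half`, `hasSum_of_pf_data_half` : the half-integer analogue of CFR Théorème 1 with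
  explicit coefficients — under `deg P ≤ A(n+1) − 2` and `P(−n−X) = (−1)^{A(n+1)+1} P(X)`,
  `Σ_{k ≥ 0} P(k+½)/(k+½)_{n+1}^A = Σ_{3 ≤ s ≤ A, s odd} (Σ_p c_{s−1,p}) (2^s − 1) ζ(s) − Σ_{o,p} c_{o,p} Ĥ_p^{(o+1)}`
  with the SAME partial-fraction data `c` as the integer series (`CressonFischlerRivoal2008.hasSum_of_pf_data`).

Everything here is exact and elementary; nothing asymptotic or arithmetic is claimed.  Lean's `x / 0 = 0`
convention is harmless: every evaluation point used is a non-pole.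
-/

namespace Summit.KontsevichZagierPeriods.Zeta5Search

open Finset Filter Topology Polynomial
open Literature.NumberTheory.Transcendental
open Literature.NumberTheory.Transcendental.BallRivoal (pfEval harm hasSum_one_div_pow_shift hasSum_sub_shift)
open Literature.NumberTheory.Irrationality.CressonFischlerRivoal2008

/-! ## Half-integer zeta tails -/

/-- The half-integer truncated sums `Ĥ_p^{(i)} = Σ_{m<p} (m + ½)^{−i} ∈ ℚ`. [this file] -/
def harmHalf (i p : ℕ) : ℚ := ∑ m ∈ range p, 1 / ((m : ℚ) + 1 / 2) ^ i

/-- `Σ_{m ≥ 0} (m + ½)^{−i} = (2^i − 1) ζ(i)` for `i ≥ 2` (split `ζ(i)` over even and odd `n`).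
[Zudilin, SIGMA 14 (2018) 028, display after Lemma 3; folklore] -/
theorem hasSum_one_div_halfInt_pow (i : ℕ) (hi : 2 ≤ i) :
    HasSum (fun m : ℕ => 1 / ((m : ℝ) + 1 / 2) ^ i) ((2 ^ i - 1) * zetaValue i) := by
  have hs : Summable (fun n : ℕ => 1 / (n : ℝ) ^ i) := Real.summable_one_div_nat_pow.2 hi
  have hinj1 : Function.Injective fun k : ℕ => 2 * k := mul_right_injective₀ two_ne_zero
  have hinj2 : Function.Injective fun k : ℕ => 2 * k + 1 := fun a b hab => by simpa using hab
  have he : Summable fun k : ℕ => 1 / (((2 * k : ℕ) : ℝ)) ^ i := hs.comp_injective hinj1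
  have ho : Summable fun k : ℕ => 1 / (((2 * k + 1 : ℕ) : ℝ)) ^ i := hs.comp_injective hinj2
  have hsplit : ∑' k : ℕ, 1 / (((2 * k : ℕ) : ℝ)) ^ i + ∑' k : ℕ, 1 / (((2 * k + 1 : ℕ) : ℝ)) ^ i =
      ∑' n : ℕ, 1 / (n : ℝ) ^ i :=
    tsum_even_add_odd (f := fun n : ℕ => 1 / (n : ℝ) ^ i) he ho
  have hZ : ∑' n : ℕ, 1 / (n : ℝ) ^ i = zetaValue i := by rw [zetaValue]
  rw [hZ] at hsplit
  have h2i : (2 : ℝ) ^ i ≠ 0 := pow_ne_zero _ two_ne_zero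
  have heven : ∑' k : ℕ, 1 / (((2 * k : ℕ) : ℝ)) ^ i = 1 / 2 ^ i * zetaValue i := by
    rw [← hZ, ← tsum_mul_left]
    refine tsum_congr fun k => ?_
    push_cast
    rw [mul_pow, one_div_mul_one_div]
  have hO : ∑' k : ℕ, 1 / (((2 * k + 1 : ℕ) : ℝ)) ^ i = zetaValue i - 1 / 2 ^ i * zetaValue i := by
    rw [← heven]; linarith
  have hO' : HasSum (fun k : ℕ => 1 / (((2 * k + 1 : ℕ) : ℝ)) ^ i)
      (zetaValue i - 1 / 2 ^ i * zetaValue i) := by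
    rw [← hO]; exact ho.hasSum
  have h2 : HasSum (fun k : ℕ => (2 : ℝ) ^ i * (1 / (((2 * k + 1 : ℕ) : ℝ)) ^ i))
      ((2 : ℝ) ^ i * (zetaValue i - 1 / 2 ^ i * zetaValue i)) := hO'.mul_left _
  convert h2 using 1
  · funext m
    push_cast
    rw [show (2 : ℝ) * m + 1 = 2 * ((m : ℝ) + 1 / 2) by ring, mul_pow, mul_one_div, ← div_div,
      div_self h2i]
  · rw [mul_sub, ← mul_assoc ((2 : ℝ) ^ i) (1 / 2 ^ i) (zetaValue i), mul_one_div_cancel h2i, one_mul]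
    ring

/-- `Σ_{k ≥ 0} (k + p + ½)^{−i} = (2^i − 1) ζ(i) − Ĥ_p^{(i)}` for `i ≥ 2`. [this file] -/
theorem hasSum_one_div_halfInt_pow_shift (i p : ℕ) (hi : 2 ≤ i) :
    HasSum (fun k : ℕ => 1 / ((k : ℝ) + p + 1 / 2) ^ i)
      ((2 ^ i - 1) * zetaValue i - (harmHalf i p : ℝ)) := by
  have h := (hasSum_nat_add_iff' (f := fun m : ℕ => 1 / ((m : ℝ) + 1 / 2) ^ i) p).2
    (hasSum_one_div_halfInt_pow i hi)
  have hval : ∑ m ∈ range p, 1 / ((m : ℝ) + 1 / 2) ^ i = (harmHalf i p : ℝ) := by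
    rw [harmHalf]; push_cast; rfl
  rw [hval] at h
  refine h.congr_fun fun k => ?_
  simp only [Nat.cast_add]

/-- `Σ_{k ≥ 0} (1/(k+½) − 1/(k+p+½)) = Ĥ_p^{(1)}` (telescoping sum of nonnegative terms). [this file] -/
theorem hasSum_sub_halfShift (p : ℕ) :
    HasSum (fun k : ℕ => 1 / ((k : ℝ) + 1 / 2) - 1 / ((k : ℝ) + p + 1 / 2)) (harmHalf 1 p : ℝ) := by
  have hnn : ∀ k : ℕ, 0 ≤ 1 / ((k : ℝ) + 1 / 2) - 1 / ((k : ℝ) + p + 1 / 2) := by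
    intro k
    rw [sub_nonneg]
    exact one_div_le_one_div_of_le (by positivity) (by linarith [(p.cast_nonneg : (0 : ℝ) ≤ p)])
  rw [hasSum_iff_tendsto_nat_of_nonneg hnn]
  set f : ℕ → ℝ := fun j => 1 / ((j : ℝ) + 1 / 2) with hf
  have hpartial : ∀ K : ℕ, ∑ k ∈ range K, (1 / ((k : ℝ) + 1 / 2) - 1 / ((k : ℝ) + p + 1 / 2)) =
      (harmHalf 1 p : ℝ) - ∑ x ∈ range p, f (K + x) := by
    intro K
    have h1 : ∑ k ∈ range K, 1 / ((k : ℝ) + p + 1 / 2) = ∑ k ∈ range K, f (p + k) := by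
      refine sum_congr rfl fun k _ => ?_
      rw [hf]
      push_cast
      ring_nf
    have h2 : ∑ x ∈ range (p + K), f x = ∑ x ∈ range p, f x + ∑ k ∈ range K, f (p + k) :=
      sum_range_add f p K
    have h3 : ∑ x ∈ range (K + p), f x = ∑ x ∈ range K, f x + ∑ x ∈ range p, f (K + x) :=
      sum_range_add f K p
    have h4 : (harmHalf 1 p : ℝ) = ∑ x ∈ range p, f x := by
      rw [harmHalf, hf]
      push_cast
      simp
    rw [sum_sub_distrib, h1, h4]
    have : p + K = K + p := add_comm _ _
    rw [this] at h2
    have h5 : ∑ k ∈ range K, 1 / ((k : ℝ) + 1 / 2) = ∑ x ∈ range K, f x := rfl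
    rw [h5]
    linarith
  simp_rw [hpartial]
  have hlim : Tendsto (fun K : ℕ => ∑ x ∈ range p, f (K + x)) atTop (𝓝 0) := by
    have : (0 : ℝ) = ∑ _x ∈ range p, (0 : ℝ) := by simp
    rw [this]
    refine tendsto_finsetSum _ fun x _ => ?_
    have h1 : Tendsto (fun K : ℕ => ((K + x : ℕ) : ℝ) + 1 / 2) atTop atTop :=
      tendsto_atTop_add_const_right _ _ (tendsto_natCast_atTop_atTop.comp (tendsto_add_atTop_nat x))
    refine (tendsto_inv_atTop_zero.comp h1).congr fun K => ?_
    simp only [Function.comp, hf, one_div]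
  simpa using (tendsto_const_nhds (x := (harmHalf 1 p : ℝ))).sub hlim

/-! ## Summation of a partial-fraction expansion at the half-integers

Half-integer analogue of `CressonFischlerRivoal2008.hasSum_partialFractions` / `hasSum_of_pf_data`: same data `c`,
`ζ(o+1)` replaced by `(2^{o+1} − 1) ζ(o+1)` and `H_p` by `Ĥ_p`. -/

/-- **Summation at the half-integers**: for partial-fraction data `c` of `F` (poles `−1,…,−(n+1)`, orders `≤ A`)
with `Σ_p c_{0,p} = 0`,
`Σ_{k ≥ 0} F(k − ½) = Σ_{1 ≤ o < A} (Σ_p c_{o,p}) (2^{o+1} − 1) ζ(o+1) − Σ_{o<A} Σ_p c_{o,p} Ĥ_p^{(o+1)}`.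
[this file; mechanism: Zudilin, SIGMA 14 (2018) 028, Lemma 3] -/
theorem hasSum_partialFractions_half (n A : ℕ) (hA : 1 ≤ A) (c : ℕ → ℕ → ℚ) (F : ℚ → ℚ)
    (hc : ∀ t : ℚ, (∀ m, m ≤ n → t + m + 1 ≠ 0) → pfEval n A c t = F t)
    (hz : ∑ p ∈ range (n + 1), c 0 p = 0) :
    HasSum (fun k : ℕ => (F ((k : ℚ) - 1 / 2) : ℝ))
      (∑ o ∈ Ico 1 A, (∑ p ∈ range (n + 1), (c o p : ℝ)) * ((2 ^ (o + 1) - 1) * zetaValue (o + 1)) -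
        ∑ o ∈ range A, ∑ p ∈ range (n + 1), (c o p : ℝ) * (harmHalf (o + 1) p : ℝ)) := by
  have hpos : ∀ k : ℕ, ∀ m, m ≤ n → (k : ℚ) - 1 / 2 + m + 1 ≠ 0 := fun k m _ => by
    apply ne_of_gt
    have hk := (Nat.cast_nonneg k : (0 : ℚ) ≤ k)
    have hm := (Nat.cast_nonneg m : (0 : ℚ) ≤ m)
    linarith
  have hexpQ : ∀ k : ℕ, F ((k : ℚ) - 1 / 2) =
      ∑ o ∈ Ico 1 A, ∑ p ∈ range (n + 1), c o p * (1 / ((k : ℚ) + p + 1 / 2) ^ (o + 1)) +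
        ∑ p ∈ range (n + 1), c 0 p * (-(1 / ((k : ℚ) + 1 / 2) - 1 / ((k : ℚ) + p + 1 / 2))) := by
    intro k
    rw [← hc _ (hpos k), pfEval, sum_comm, range_eq_Ico, sum_eq_sum_Ico_succ_bot hA, add_comm]
    congr 1
    · refine sum_congr rfl fun o _ => sum_congr rfl fun p _ => ?_
      rw [div_eq_mul_one_div, show (k : ℚ) - 1 / 2 + p + 1 = (k : ℚ) + p + 1 / 2 by ring]
    · simp only [zero_add, pow_one]
      have hz' : ∑ p ∈ range (n + 1), c 0 p * (1 / ((k : ℚ) + 1 / 2)) = 0 := by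
        rw [← sum_mul, hz, zero_mul]
      calc ∑ p ∈ range (n + 1), c 0 p / ((k : ℚ) - 1 / 2 + p + 1)
          = ∑ p ∈ range (n + 1), c 0 p / ((k : ℚ) - 1 / 2 + p + 1) -
              ∑ p ∈ range (n + 1), c 0 p * (1 / ((k : ℚ) + 1 / 2)) := by rw [hz', sub_zero]
        _ = _ := by
            rw [← sum_sub_distrib]
            exact sum_congr rfl fun p _ => by ring
  have hfun : (fun k : ℕ => (F ((k : ℚ) - 1 / 2) : ℝ)) = fun k : ℕ =>
      ∑ o ∈ Ico 1 A, ∑ p ∈ range (n + 1), (c o p : ℝ) * (1 / ((k : ℝ) + p + 1 / 2) ^ (o + 1)) +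
        ∑ p ∈ range (n + 1), (c 0 p : ℝ) * (-(1 / ((k : ℝ) + 1 / 2) - 1 / ((k : ℝ) + p + 1 / 2))) := by
    funext k
    rw [hexpQ]
    push_cast
    ring
  have hA' : ∀ o ∈ Ico 1 A, HasSum (fun k : ℕ => ∑ p ∈ range (n + 1),
      (c o p : ℝ) * (1 / ((k : ℝ) + p + 1 / 2) ^ (o + 1)))
      (∑ p ∈ range (n + 1), (c o p : ℝ) *
        ((2 ^ (o + 1) - 1) * zetaValue (o + 1) - (harmHalf (o + 1) p : ℝ))) := by
    intro o ho
    have ho' : 2 ≤ o + 1 := by have := (mem_Ico.1 ho).1; omega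
    exact hasSum_sum fun p _ => (hasSum_one_div_halfInt_pow_shift (o + 1) p ho').mul_left _
  have hB : ∀ p ∈ range (n + 1), HasSum (fun k : ℕ =>
      (c 0 p : ℝ) * (-(1 / ((k : ℝ) + 1 / 2) - 1 / ((k : ℝ) + p + 1 / 2))))
      ((c 0 p : ℝ) * (-(harmHalf 1 p : ℝ))) := by
    intro p _
    have h := ((hasSum_sub_halfShift p).mul_left (c 0 p : ℝ)).neg
    have e1 : (fun k : ℕ => (c 0 p : ℝ) * (-(1 / ((k : ℝ) + 1 / 2) - 1 / ((k : ℝ) + p + 1 / 2)))) =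
        fun k : ℕ => -((c 0 p : ℝ) * (1 / ((k : ℝ) + 1 / 2) - 1 / ((k : ℝ) + p + 1 / 2))) :=
      funext fun k => by ring
    rw [e1, show (c 0 p : ℝ) * (-(harmHalf 1 p : ℝ)) = -((c 0 p : ℝ) * harmHalf 1 p) by ring]
    exact h
  have hAB := (hasSum_sum hA').add (hasSum_sum hB)
  rw [hfun]
  convert hAB using 1
  rw [range_eq_Ico A, sum_eq_sum_Ico_succ_bot hA]
  simp only [mul_sub, sum_sub_distrib, sum_mul, mul_neg, sum_neg_distrib, zero_add]
  ring

/-- **CFR Théorème 1 at the half-integers, with explicit coefficients**: under the hypotheses of Théorème 1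
(`A ≥ 1`, `deg P ≤ A(n+1) − 2`, `P(−n−X) = (−1)^{A(n+1)+1} P(X)`), for ANY partial-fraction data `c` of
`P(t+1)/(t+1)_{n+1}^A`,
`Σ_{k ≥ 0} P(k+½)/(k+½)_{n+1}^A = Σ_{3 ≤ s ≤ A, s odd} (Σ_p c_{s−1,p}) (2^s − 1) ζ(s) − Σ_{o<A} Σ_p c_{o,p} Ĥ_p^{(o+1)}`:
the SAME coefficients `Σ_p c_{s−1,p}` as the integer series (`CressonFischlerRivoal2008.hasSum_of_pf_data`), each
`ζ(s)` weighted by `2^s − 1`, even `s` absent. [this file; mechanism: Zudilin, SIGMA 14 (2018) 028, Lemma 3] -/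
theorem hasSum_of_pf_data_half (n A : ℕ) (P : ℚ[X]) (hA : 1 ≤ A) (hdeg : P.natDegree + 2 ≤ A * (n + 1))
    (hsym : P.comp (-(n : ℚ[X]) - X) = (-1 : ℚ[X]) ^ (A * (n + 1) + 1) * P) (c : ℕ → ℕ → ℚ)
    (hc : ∀ t : ℚ, (∀ p, p ≤ n → t + p + 1 ≠ 0) →
      pfEval n A c t = (P.comp (X + C 1)).eval t / BallRivoal.poch (t + 1) (n + 1) ^ A) :
    HasSum (fun k : ℕ =>
        ((P.eval ((k : ℚ) + 1 / 2) / BallRivoal.poch ((k : ℚ) + 1 / 2) (n + 1) ^ A : ℚ) : ℝ))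
      (∑ s ∈ (Icc 3 A).filter Odd, (∑ p ∈ range (n + 1), (c (s - 1) p : ℝ)) * ((2 ^ s - 1) * zetaValue s) -
        ∑ o ∈ range A, ∑ p ∈ range (n + 1), (c o p : ℝ) * (harmHalf (o + 1) p : ℝ)) := by
  set Q : ℚ[X] := P.comp (X + C 1) with hQdef
  have hQnat : Q.natDegree = P.natDegree := by
    rw [hQdef, natDegree_comp, natDegree_X_add_C, mul_one]
  have hz : ∑ p ∈ range (n + 1), c 0 p = 0 :=
    partialFractions_sum_order_zero n A hA Q (by omega) c hc
  have hS := hasSum_partialFractions_half n A hA c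
    (fun t => Q.eval t / BallRivoal.poch (t + 1) (n + 1) ^ A) hc hz
  have hfun : (fun k : ℕ =>
      ((P.eval ((k : ℚ) + 1 / 2) / BallRivoal.poch ((k : ℚ) + 1 / 2) (n + 1) ^ A : ℚ) : ℝ)) =
      fun k : ℕ => (((fun t : ℚ => Q.eval t / BallRivoal.poch (t + 1) (n + 1) ^ A)
        ((k : ℚ) - 1 / 2) : ℚ) : ℝ) := by
    funext k
    simp only [hQdef, eval_comp, eval_add, eval_X, eval_C]
    rw [show (k : ℚ) - 1 / 2 + 1 = (k : ℚ) + 1 / 2 by ring]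
  -- the value: even orders vanish, reindex `s = o + 1`
  have hval : ∑ o ∈ Ico 1 A, (∑ p ∈ range (n + 1), (c o p : ℝ)) * ((2 ^ (o + 1) - 1) * zetaValue (o + 1)) =
      ∑ s ∈ (Icc 3 A).filter Odd, (∑ p ∈ range (n + 1), (c (s - 1) p : ℝ)) * ((2 ^ s - 1) * zetaValue s) := by
    have h1 : ∑ o ∈ Ico 1 A, (∑ p ∈ range (n + 1), (c o p : ℝ)) * ((2 ^ (o + 1) - 1) * zetaValue (o + 1)) =
        ∑ s ∈ Ico 2 (A + 1), (∑ p ∈ range (n + 1), (c (s - 1) p : ℝ)) * ((2 ^ s - 1) * zetaValue s) := by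
      rw [← sum_Ico_add' (fun s => (∑ p ∈ range (n + 1), (c (s - 1) p : ℝ)) * ((2 ^ s - 1) * zetaValue s))
        1 A 1]
      simp only [Nat.add_sub_cancel]
    have h2 : (Ico 2 (A + 1)).filter Odd = (Icc 3 A).filter Odd := by
      ext s
      simp only [mem_filter, mem_Ico, mem_Icc]
      constructor
      · rintro ⟨⟨h2, h3⟩, ho⟩
        obtain ⟨m, hm⟩ := id ho
        exact ⟨⟨by omega, by omega⟩, ho⟩
      · rintro ⟨⟨h2, h3⟩, ho⟩
        exact ⟨⟨by omega, by omega⟩, ho⟩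
    have h3 : ∑ s ∈ (Ico 2 (A + 1)).filter (fun s => ¬Odd s),
        (∑ p ∈ range (n + 1), (c (s - 1) p : ℝ)) * ((2 ^ s - 1) * zetaValue s) = 0 := by
      refine sum_eq_zero fun s hs => ?_
      obtain ⟨hs, hso⟩ := mem_filter.1 hs
      have hs' := mem_Ico.1 hs
      have hodd : Odd (s - 1) := by
        rcases Nat.even_or_odd s with he' | ho'
        · obtain ⟨m, hm⟩ := he'
          exact ⟨m - 1, by omega⟩
        · exact absurd ho' hso
      have h0 : ∑ p ∈ range (n + 1), c (s - 1) p = 0 :=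
        partialFractions_sum_odd_order n A P hsym c hc (s - 1) (by omega) hodd
      have h0' : ∑ p ∈ range (n + 1), (c (s - 1) p : ℝ) = 0 := by exact_mod_cast h0
      rw [h0', zero_mul]
    rw [h1, ← sum_filter_add_sum_filter_not (Ico 2 (A + 1)) Odd, h3, add_zero, h2]
  rw [hfun]
  convert hS using 1
  rw [hval]

end Summit.KontsevichZagierPeriods.Zeta5Search
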